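import Summits.QuantumFields.YangMills.Theorems.ContinuumLimitOnTrajectory.Negative.UltralocalZeroCoupling

/-!
# `ContinuumLimitOnTrajectory` — negative-side support III: exact factorisation of the `tr F²` two-point function at zero coupling

Support file 3/4 for crux `stmt-QuantumFields-10522` ((A) of `ParabolicTrajectory`), from the disprover's work
file §2. Tree objects only (`smearedLatticeField`, `latticeSchwinger`).

* `proj_injOn_box`, `smearedLatticeField_torusLift`, `integral_sub_mul_sub`.
* `integral_smeared_mul_smeared`: for weights with `w x · w' x = 0` the product Haar expectation of the product
  of two smeared curvature fields is the product of the expectations — exactly, on every torus `2L+1 ≥ 3`,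
  for all renormalisation constants.
* `latticeSchwinger_one`, `latticeSchwinger_two`, `latticeSchwinger_two_eq_mul`: at `β = 0` the off-diagonal
  lattice two-point function of the curvature species factorises, `⟨Φ(u)Φ(v)⟩_k = ⟨Φ(u)⟩_k ⟨Φ(v)⟩_k`
  (`u · v ≡ 0`, `L_k ≥ 1`).
-/

namespace Summit.QuantumFields.YangMills.Theorems.ContinuumLimitOnTrajectory.Negative

open MeasureTheory Filter Topology
open Literature.MathematicalPhysics.QuantumFieldTheory Literature.MathematicalPhysics.QuantumLattice
open Literature.Probability.LatticeModels (Torus.proj Torus.proj_apply)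

noncomputable section

section TwoPoint

open Literature.Probability.LatticeModels (box mem_box)

variable {G : Type} [Group G] [TopologicalSpace G] [IsTopologicalGroup G] [CompactSpace G]
  [MeasurableSpace G] [BorelSpace G] [SecondCountableTopology G]
  {N : ℕ} (ρ : G →* Matrix (Fin N) (Fin N) ℂ)

/-- `Torus.proj (2L+1)` is injective on the fundamental domain `box 4 L`. [folklore] -/
theorem proj_injOn_box (L : ℕ) :
    Set.InjOn (Torus.proj (d := 4) (2 * L + 1)) (box 4 L : Set (Literature.Probability.LatticeModels.Site 4)) := by
  intro x hx y hy hxy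
  funext k
  have hk : ((x k : ℤ) : ZMod (2 * L + 1)) = ((y k : ℤ) : ZMod (2 * L + 1)) := congrFun hxy k
  rw [ZMod.intCast_eq_intCast_iff_dvd_sub] at hk
  obtain ⟨hx1, hx2⟩ := mem_box.1 (Finset.mem_coe.1 hx) k
  obtain ⟨hy1, hy2⟩ := mem_box.1 (Finset.mem_coe.1 hy) k
  have hlt : |y k - x k| < ((2 * L + 1 : ℕ) : ℤ) := by
    rw [abs_lt]; push_cast; constructor <;> linarith
  have h0 := Int.eq_zero_of_abs_lt_dvd hk hlt
  linarith

omit [SecondCountableTopology G] [TopologicalSpace G] [IsTopologicalGroup G] [CompactSpace G]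
  [BorelSpace G] in
/-- The smeared curvature field of the periodic lift, in torus variables. [folklore] -/
theorem smearedLatticeField_torusLift (L : ℕ) (a c m : ℝ) (f : SchwartzMap (EuclideanSpace ℝ (Fin 4)) ℝ)
    (U : GaugeConfig 4 (2 * L + 1) G) :
    smearedLatticeField (actionDensity ρ) (box 4 L) a c m f (torusLift (2 * L + 1) U) =
      c * a ^ 4 * ∑ x ∈ box 4 L, f (a • siteToE x) *
        (torusDensity ρ (2 * L + 1) (Torus.proj (2 * L + 1) x) U - m) := by
  unfold smearedLatticeField
  congr 1
  refine Finset.sum_congr rfl fun x _ => ?_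
  rw [actionDensity_shift_torusLift]

omit [CompactSpace G] [MeasurableSpace G] [BorelSpace G] [SecondCountableTopology G] in
/-- The torus density is continuous. [folklore] -/
theorem continuous_torusDensity (hρ : Continuous ρ) (S : ℕ) (X : Site 4 S) :
    Continuous (torusDensity ρ S X) := by
  unfold torusDensity
  exact continuous_finsetSum _ fun p _ => continuous_plaqTerm ρ S hρ X p

/-- Linearity: a weighted finite sum under the integral. [folklore] -/
theorem integral_sum_mul_left {α X : Type*} [MeasurableSpace X] (μ : Measure X) (B : Finset α)
    (κ : α → ℝ) (g : α → X → ℝ) (hg : ∀ x ∈ B, Integrable (g x) μ) :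
    ∫ U, ∑ x ∈ B, κ x * g x U ∂μ = ∑ x ∈ B, κ x * ∫ U, g x U ∂μ := by
  rw [integral_finsetSum _ fun x hx => (hg x hx).const_mul (κ x)]
  exact Finset.sum_congr rfl fun x _ => integral_const_mul _ _

/-- Linearity: a weighted finite double sum under the integral. [folklore] -/
theorem integral_sum_sum_mul_left {α X : Type*} [MeasurableSpace X] (μ : Measure X)
    (B : Finset α) (κ : α → α → ℝ) (g : α → α → X → ℝ) (hg : ∀ x y, Integrable (g x y) μ) :
    ∫ U, ∑ x ∈ B, ∑ y ∈ B, κ x y * g x y U ∂μ = ∑ x ∈ B, ∑ y ∈ B, κ x y * ∫ U, g x y U ∂μ := by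
  rw [integral_finsetSum _ fun x _ =>
    integrable_finsetSum _ fun y _ => (hg x y).const_mul (κ x y)]
  exact Finset.sum_congr rfl fun x _ => integral_sum_mul_left μ B (κ x) (g x) fun y _ => hg x y

/-- Shifted second moment of the density at distinct torus sites factorises (`β = 0`). [folklore] -/
theorem integral_sub_mul_sub {S : ℕ} [NeZero S] (hS : (1 : ZMod S) ≠ 0) (hρ : Continuous ρ)
    {X Y : Site 4 S} (hXY : X ≠ Y) (m m' : ℝ) :
    ∫ U, (torusDensity ρ S X U - m) * (torusDensity ρ S Y U - m') ∂piHaar S =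
      (∫ U, (torusDensity ρ S X U - m) ∂piHaar S) * ∫ U, (torusDensity ρ S Y U - m') ∂piHaar S := by
  have hX := continuous_torusDensity ρ hρ S X
  have hY := continuous_torusDensity ρ hρ S Y
  have iX : Integrable (fun U => torusDensity ρ S X U) (piHaar S) := integrable_of_continuous S hX
  have iY : Integrable (fun U => torusDensity ρ S Y U) (piHaar S) := integrable_of_continuous S hY
  have iXY : Integrable (fun U => torusDensity ρ S X U * torusDensity ρ S Y U) (piHaar S) :=
    integrable_of_continuous S (hX.mul hY)
  have i1 : Integrable (fun U => torusDensity ρ S X U * torusDensity ρ S Y U -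
      m' * torusDensity ρ S X U) (piHaar S) := iXY.sub (iX.const_mul m')
  have i2 : Integrable (fun U => m * torusDensity ρ S Y U - m * m') (piHaar S) :=
    (iY.const_mul m).sub (integrable_const _)
  have e : ∀ U, (torusDensity ρ S X U - m) * (torusDensity ρ S Y U - m') =
      torusDensity ρ S X U * torusDensity ρ S Y U - m' * torusDensity ρ S X U -
        (m * torusDensity ρ S Y U - m * m') := by intro U; ring
  simp_rw [e]
  rw [integral_sub i1 i2,
    integral_sub iXY (iX.const_mul m'), integral_sub (iY.const_mul m) (integrable_const _),
    integral_const_mul, integral_const_mul, integral_const, probReal_univ, one_smul,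
    integral_torusDensity_mul ρ S hS hρ hXY, integral_sub iX (integrable_const _),
    integral_sub iY (integrable_const _), integral_const, integral_const, probReal_univ, one_smul,
    one_smul]
  ring

/-- **Two-point factorisation at `β = 0` for diagonal-free weights.** For weights with
`w x · w' x = 0` (e.g. test functions with disjoint supports), the product Haar expectation of
the product of two smeared curvature fields is the product of their expectations — exactly,
on every torus `2L+1 ≥ 3`, for all renormalisation constants. [folklore] -/
theorem integral_smeared_mul_smeared {L : ℕ} (hL : 1 ≤ L) (hρ : Continuous ρ) (a c c' m m' : ℝ)
    (w w' : Literature.Probability.LatticeModels.Site 4 → ℝ) (hww' : ∀ x, w x * w' x = 0) :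
    ∫ U, (c * a ^ 4 * ∑ x ∈ box 4 L, w x *
        (torusDensity ρ (2 * L + 1) (Torus.proj (2 * L + 1) x) U - m)) *
      (c' * a ^ 4 * ∑ y ∈ box 4 L, w' y *
        (torusDensity ρ (2 * L + 1) (Torus.proj (2 * L + 1) y) U - m')) ∂piHaar (2 * L + 1) =
    (∫ U, c * a ^ 4 * ∑ x ∈ box 4 L, w x *
        (torusDensity ρ (2 * L + 1) (Torus.proj (2 * L + 1) x) U - m) ∂piHaar (2 * L + 1)) *
      ∫ U, c' * a ^ 4 * ∑ y ∈ box 4 L, w' y *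
        (torusDensity ρ (2 * L + 1) (Torus.proj (2 * L + 1) y) U - m') ∂piHaar (2 * L + 1) := by
  have hS : (1 : ZMod (2 * L + 1)) ≠ 0 := one_ne_zero_zmod (by omega)
  obtain ⟨D, hD⟩ : ∃ D : Literature.Probability.LatticeModels.Site 4 → GaugeConfig 4 (2 * L + 1) G → ℝ,
      ∀ x U, D x U = torusDensity ρ (2 * L + 1) (Torus.proj (2 * L + 1) x) U := ⟨_, fun _ _ => rfl⟩
  simp only [← hD]
  have hDc : ∀ x, Continuous (D x) := fun x => by
    rw [show D x = _ from funext (hD x)]; exact continuous_torusDensity ρ hρ (2 * L + 1) _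
  have iD : ∀ x (μ : ℝ), Integrable (fun U => D x U - μ) (piHaar (2 * L + 1)) := fun x μ =>
    integrable_of_continuous (2 * L + 1) ((hDc x).sub continuous_const)
  have iDD : ∀ x y, Integrable (fun U => (D x U - m) * (D y U - m')) (piHaar (2 * L + 1)) :=
    fun x y => integrable_of_continuous (2 * L + 1)
      (((hDc x).sub continuous_const).mul ((hDc y).sub continuous_const))
  -- pointwise expansion of the product of the two smeared fields
  have hexp : ∀ U, (c * a ^ 4 * ∑ x ∈ box 4 L, w x * (D x U - m)) *
      (c' * a ^ 4 * ∑ y ∈ box 4 L, w' y * (D y U - m')) =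
      (c * a ^ 4 * (c' * a ^ 4)) *
        ∑ x ∈ box 4 L, ∑ y ∈ box 4 L, (w x * w' y) * ((D x U - m) * (D y U - m')) := by
    intro U
    rw [show (c * a ^ 4 * ∑ x ∈ box 4 L, w x * (D x U - m)) *
        (c' * a ^ 4 * ∑ y ∈ box 4 L, w' y * (D y U - m')) = (c * a ^ 4 * (c' * a ^ 4)) *
        ((∑ x ∈ box 4 L, w x * (D x U - m)) * ∑ y ∈ box 4 L, w' y * (D y U - m')) by ring,
      Finset.sum_mul_sum]
    congr 1
    exact Finset.sum_congr rfl fun x _ => Finset.sum_congr rfl fun y _ => by ring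
  simp_rw [hexp]
  rw [integral_const_mul, integral_sum_sum_mul_left _ _ (fun x y => w x * w' y)
    (fun x y U => (D x U - m) * (D y U - m')) iDD]
  -- the two one-point expectations
  rw [integral_const_mul, integral_const_mul,
    integral_sum_mul_left _ _ w (fun x U => D x U - m) fun x _ => iD x m,
    integral_sum_mul_left _ _ w' (fun y U => D y U - m') fun y _ => iD y m']
  rw [show (c * a ^ 4 * ∑ x ∈ box 4 L, w x * ∫ U, (D x U - m) ∂piHaar (2 * L + 1)) *
      (c' * a ^ 4 * ∑ y ∈ box 4 L, w' y * ∫ U, (D y U - m') ∂piHaar (2 * L + 1)) =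
      (c * a ^ 4 * (c' * a ^ 4)) * ((∑ x ∈ box 4 L, w x * ∫ U, (D x U - m) ∂piHaar (2 * L + 1)) *
        ∑ y ∈ box 4 L, w' y * ∫ U, (D y U - m') ∂piHaar (2 * L + 1)) by ring, Finset.sum_mul_sum]
  congr 1
  refine Finset.sum_congr rfl fun x hx => Finset.sum_congr rfl fun y hy => ?_
  by_cases hxy : x = y
  · subst hxy
    rcases mul_eq_zero.1 (hww' x) with h | h <;> simp [h]
  · have hXY : Torus.proj (2 * L + 1) x ≠ Torus.proj (2 * L + 1) y := fun h =>
      hxy (proj_injOn_box L (Finset.mem_coe.2 hx) (Finset.mem_coe.2 hy) h)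
    rw [show (∫ U, (D x U - m) * (D y U - m') ∂piHaar (2 * L + 1)) =
        (∫ U, (D x U - m) ∂piHaar (2 * L + 1)) * ∫ U, (D y U - m') ∂piHaar (2 * L + 1) by
      simp only [hD]; exact integral_sub_mul_sub ρ hS hρ hXY m m']
    ring

end TwoPoint

section LatticeTwoPoint

open Literature.Probability.LatticeModels (box mem_box)

variable {G : Type} [Group G] [TopologicalSpace G] [IsTopologicalGroup G] [CompactSpace G]
  [MeasurableSpace G] [BorelSpace G]

local notation "𝔼" => EuclideanSpace ℝ (Fin 4)

/-- The lattice one-point function of the curvature species on one real test function. [folklore] -/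
theorem latticeSchwinger_one (r : LatticeRep G) (sch : SpeciesScheme (YMSpecies G)) (k : ℕ)
    (u : SchwartzMap 𝔼 ℝ) :
    latticeSchwinger r.ρ sch (fun s => s.F) k 1 (fun _ => r.curvature) ![u] =
      ∫ U, smearedLatticeField (actionDensity r.ρ) (box 4 (sch.L k)) (sch.a k)
        (sch.c r.curvature k) (sch.m r.curvature k) u (torusLift (sch.side k) U)
        ∂(wilsonMeasure (d := 4) (L := sch.side k) r.ρ (sch.β k)) := by
  unfold latticeSchwinger
  simp only [Fin.prod_univ_one, Matrix.cons_val_zero, curvature_F]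

/-- The lattice two-point function of the curvature species on two real test functions. [folklore] -/
theorem latticeSchwinger_two (r : LatticeRep G) (sch : SpeciesScheme (YMSpecies G)) (k : ℕ)
    (u v : SchwartzMap 𝔼 ℝ) :
    latticeSchwinger r.ρ sch (fun s => s.F) k (1 + 1) (fun _ => r.curvature) ![u, v] =
      ∫ U, smearedLatticeField (actionDensity r.ρ) (box 4 (sch.L k)) (sch.a k)
          (sch.c r.curvature k) (sch.m r.curvature k) u (torusLift (sch.side k) U) *
        smearedLatticeField (actionDensity r.ρ) (box 4 (sch.L k)) (sch.a k)
          (sch.c r.curvature k) (sch.m r.curvature k) v (torusLift (sch.side k) U)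
        ∂(wilsonMeasure (d := 4) (L := sch.side k) r.ρ (sch.β k)) := by
  unfold latticeSchwinger
  simp only [Fin.prod_univ_succ, Fin.prod_univ_zero, mul_one, Matrix.cons_val_zero,
    Matrix.cons_val_succ, curvature_F]

/-- **At `β = 0` the off-diagonal lattice two-point function of `tr F²` FACTORISES EXACTLY**
(every torus `2L_k+1 ≥ 3`, all renormalisation constants): for real test functions with
`u · v ≡ 0`, `⟨Φ(u) Φ(v)⟩_k = ⟨Φ(u)⟩_k ⟨Φ(v)⟩_k`. [folklore] -/
theorem latticeSchwinger_two_eq_mul (r : LatticeRep G) (sch : SpeciesScheme (YMSpecies G))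
    {k : ℕ} (hβ : sch.β k = 0) (hL : 1 ≤ sch.L k) {u v : SchwartzMap 𝔼 ℝ}
    (huv : ∀ z, u z * v z = 0) :
    latticeSchwinger r.ρ sch (fun s => s.F) k (1 + 1) (fun _ => r.curvature) ![u, v] =
      latticeSchwinger r.ρ sch (fun s => s.F) k 1 (fun _ => r.curvature) ![u] *
        latticeSchwinger r.ρ sch (fun s => s.F) k 1 (fun _ => r.curvature) ![v] := by
  haveI : SecondCountableTopology G :=
    (r.continuous.isClosedEmbedding r.injective).isEmbedding.secondCountableTopology
  rw [latticeSchwinger_two, latticeSchwinger_one, latticeSchwinger_one, hβ]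
  simp only [SpeciesScheme.side]
  rw [wilsonMeasure_zero]
  simp only [smearedLatticeField_torusLift]
  exact integral_smeared_mul_smeared r.ρ hL r.continuous _ _ _ _ _ _ _
    fun x => huv _

end LatticeTwoPoint

end

end Summit.QuantumFields.YangMills.Theorems.ContinuumLimitOnTrajectory.Negative
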